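import Literature.AlgebraicGeometry.Motives.MixedHodgeStructureCatWeightGradedObject
import Literature.AlgebraicGeometry.Motives.MixedHodgeStructureSplitOverQCharacterisation
import HarnessLib

/-!
# Finite direct sums in `MixedHodgeStructureCat` are the product MHS, and `X ≅ ⨁_j Gr^W_j X` iff `X` is split over `ℚ`

Layer `Literature/AlgebraicGeometry/Motives` (lane `lit-hodgefound`), bridging g44-#12 (`Motives/MixedHodgeStructureCatWeightGradedObject`: the
categorical associated graded `grTotal s X = ⨁_{j ∈ s} (ofPure j)(Gr^W_j X)`) with the tree's UNBUNDLED theory of `ℚ`-split mixed Hodge structures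
(`Motives/MixedHodgeStructureSplitOverQ…`: `IsSplitOverQ H` — every eigenspace of the Deligne grading is defined over `ℚ` — and its characterisation
`isSplitOverQ_iff_exists_hom_pi_gr_bijective`: `H` is `ℚ`-split iff `⊕_{n ∈ s} Gr^W_n H ⥲ H` through the product MHS `MixedHodgeStructure.pi`).

* §1 **finite products in `MixedHodgeStructureCat` are the product MHS**: `piObj F = of (MixedHodgeStructure.pi fun j => (F j).str)` with its
  projections is a limit fan (`piFanIsLimit`), whence `piIsoPiObj : ∏ᶜ F ≅ piObj F` and `biproductIsoPiObj : ⨁ F ≅ piObj F` (the finite-family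
  version of `prodIsoProdObj`, `Motives/MixedHodgeStructureCatGradedPolarizable`);
* §2 `grTotalObjIsoPi : (grTotal s) X ≅ of (MixedHodgeStructure.pi fun n : ↥s => (X.str.gr n).toMixedHodgeStructure)`; `(grTotal s) X` is
  finite-dimensional with `X`, and is itself split over `ℚ`;
* §3 **`X` is split over `ℚ` iff `(grTotal s) X ≅ X`** for any finite `s ⊇` (weights of `X`) (`isSplitOverQ_iff_nonempty_grTotal_obj_iso`), and
  consequently **a graded-polarizable `ℚ`-split `X` is a semisimple object** (`isSemisimpleObj_of_isSplitOverQ`, from g44-#12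
  `isSemisimpleObj_grTotal_obj`; the unbundled counterpart, for the tree's lattice-theoretic `MixedHodgeStructure.IsSemisimple`, is
  `IsSplitOverQ.isSemisimple` in `Motives/MixedHodgeStructureSemisimple`).  (An analogous `piObj` for INTEGRAL Hodge structures lives in
  `HodgeTheory/ComplexTorusIntegralKunnethDecomposition`, namespace `IntHodgeStructureCat`.)

Everything is PROVED; definitions with bodies; no named fact, no instance, no notation; `[HasFiniteBiproducts MixedHodgeStructureCat]` carried
as a hypothesis where biproducts occur (the tree's theorem `hasFiniteBiproducts`).

Sources, verbatim.  M. Green, P. Griffiths, M. Kerr, *Mumford–Tate Groups and Domains* (2012) [GreenGriffithsKerr2012], §I.C (I.C.7) `V^split =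
⊕ᵢ Gr^W_i V`, (I.C.11) (iii) «`V^split` is a direct sum of pure Hodge structures», footnote 3 «the case of `ℚ`-split MHS, i.e., "general Hodge
structures"» (quoted in the tree's `MixedHodgeStructureSplitOverQCharacterisation`).  E. Cattani, F. El Zein, P. A. Griffiths, Lê D. T. (eds.),
*Hodge Theory* (2014) [CattaniElZeinGriffithsLe2014] (held text `book:cattani2014-hodge-theory-princeton-mathematical-notes-49`): Ex. 3.2.23 (2)
(p0163, direct sums of MHS), Thm. 3.2.18 (p0160–p0161, MHS form an abelian category).  C. Voisin, *Hodge Theory and Complex Algebraic Geometry I*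
[VoisinHodgeI2002], §7.3.1 Lemma 7.26 (through g44-#12).

## Main definitions and results

* §1 `piObj`, `piObj_str`, `piFan`, `piFan_proj`, `piFanIsLimit`, `piIsoPiObj`, `biproductIsoPiObj`, `finite_piObj`.
* §2 `grTotalObjIsoPi`, `finite_grTotal_obj`, `isSplitOverQ_grTotal_obj`.
* §3 `weightForm_eq_bot_of_not_isWeight`, **`nonempty_grTotal_obj_iso_of_isSplitOverQ`**, **`isSplitOverQ_of_grTotal_obj_iso`**,
  **`isSplitOverQ_iff_nonempty_grTotal_obj_iso`**, **`isSemisimpleObj_of_isSplitOverQ`**.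

## References

* [GreenGriffithsKerr2012] M. Green, P. Griffiths, M. Kerr, Mumford–Tate Groups and Domains, Annals of Math. Studies 183 (2012), §I.C (I.C.7),
  (I.C.11) (iii), footnote 3.
* [CattaniElZeinGriffithsLe2014] E. Cattani et al. (eds.), Hodge Theory, Princeton Math. Notes 49 (2014), Thm. 3.2.18, Ex. 3.2.23 (2).
* [VoisinHodgeI2002] C. Voisin, Hodge Theory and Complex Algebraic Geometry I (2002), §7.3.1, Lemma 7.26.

## Provenance

Lane `lit-hodgefound` (summit `HodgeConjecture`), seat `lit-hodgefound-p36` (literature-prover, generation 44, row g44-#15).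
-/

noncomputable section

open CategoryTheory CategoryTheory.Limits

namespace Literature.AlgebraicGeometry.Motives

open Literature.CategoryTheory.KrullSchmidt

universe u

namespace MixedHodgeStructureCat

/-! ## §1 Finite products in `MixedHodgeStructureCat` are the product MHS -/

section Pi

variable {J : Type} [Fintype J] [DecidableEq J] (F : J → MixedHodgeStructureCat.{u})

/-- **The direct sum `⊕ⱼ Fⱼ` of a finite family of mixed Hodge structures as an object** (the tree's `MixedHodgeStructure.pi` on `Π j, F j`).
[cite: CattaniElZeinGriffithsLe2014, Ex. 3.2.23 (2)] -/
def piObj : MixedHodgeStructureCat.{u} := of (MixedHodgeStructure.pi fun j => (F j).str)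

/-- The MHS of `piObj F` is `MixedHodgeStructure.pi` (by `rfl`). [cite: CattaniElZeinGriffithsLe2014, Ex. 3.2.23 (2)] -/
theorem piObj_str : (piObj F).str = MixedHodgeStructure.pi fun j => (F j).str := rfl

/-- The fan of the projections `⊕ⱼ Fⱼ → Fⱼ`. [cite: CattaniElZeinGriffithsLe2014, Ex. 3.2.23 (2)] -/
def piFan : Fan F := Fan.mk (piObj F) fun j => (MixedHodgeStructure.Hom.proj (fun i => (F i).str) j : piObj F ⟶ F j)

/-- The projections of `piFan` (by `rfl`). [cite: CattaniElZeinGriffithsLe2014, Ex. 3.2.23 (2)] -/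
theorem piFan_proj_toLinearMap_apply (j : J) (x : piObj F) : ((piFan F).proj j).toLinearMap x = x j := rfl

/-- **`⊕ⱼ Fⱼ` with its projections is a product in `MixedHodgeStructureCat`** (pairing `MixedHodgeStructure.Hom.piLift`).
[cite: CattaniElZeinGriffithsLe2014, Ex. 3.2.23 (2)] -/
def piFanIsLimit : IsLimit (piFan F) :=
  Fan.IsLimit.mk _ (fun c => (MixedHodgeStructure.Hom.piLift (fun i => (F i).str) (fun j => c.proj j) : c.pt ⟶ piObj F))
    (fun _ _ => MixedHodgeStructure.Hom.ext (LinearMap.ext fun _ => rfl))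
    fun c _ hm => MixedHodgeStructure.Hom.ext (LinearMap.ext fun x => funext fun j =>
      congrArg (fun φ : c.pt ⟶ F j => φ.toLinearMap x) (hm j))

/-- Hence **`∏ᶜ F ≅ ⊕ⱼ Fⱼ`**: the categorical product of a finite family is the direct sum. [cite: CattaniElZeinGriffithsLe2014, Ex. 3.2.23 (2)] -/
def piIsoPiObj [HasProduct F] : ∏ᶜ F ≅ piObj F :=
  (limit.isLimit (Discrete.functor F)).conePointUniqueUpToIso (piFanIsLimit F)

/-- And **`⨁ⱼ Fⱼ ≅ ⊕ⱼ Fⱼ`**: the biproduct of a finite family is the direct sum. [cite: CattaniElZeinGriffithsLe2014, Ex. 3.2.23 (2)] -/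
def biproductIsoPiObj [HasFiniteBiproducts MixedHodgeStructureCat.{u}] : ⨁ F ≅ piObj F :=
  biproduct.isoProduct F ≪≫ piIsoPiObj F

/-- `⊕ⱼ Fⱼ` is finite-dimensional when the `Fⱼ` are. [cite: CattaniElZeinGriffithsLe2014, Ex. 3.2.23 (2)] -/
theorem finite_piObj [∀ j, Module.Finite ℚ (F j)] : Module.Finite ℚ (piObj F) :=
  inferInstanceAs (Module.Finite ℚ (∀ j, F j))

end Pi

/-! ## §2 `(grTotal s) X` is the product MHS `⊕_{n ∈ s} Gr^W_n X` -/

section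

variable [HasFiniteBiproducts MixedHodgeStructureCat.{u}] (s : Finset ℤ)

/-- **`(grTotal s) X ≅ of (MixedHodgeStructure.pi fun n : s => Gr^W_n X)`**: the categorical associated graded is the tree's product MHS of the graded
pieces. [cite: GreenGriffithsKerr2012, §I.C (I.C.7)] [cite: CattaniElZeinGriffithsLe2014, Ex. 3.2.23 (2)] -/
def grTotalObjIsoPi (X : MixedHodgeStructureCat.{u}) :
    (grTotal s).obj X ≅ of (MixedHodgeStructure.pi fun n : ↥s => (X.str.gr n).toMixedHodgeStructure) :=
  biproductIsoPiObj fun j : s => (ofPure (j : ℤ)).obj ((gr (j : ℤ)).obj X)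

/-- `(grTotal s) X` is finite-dimensional when `X` is. [cite: CattaniElZeinGriffithsLe2014, Ex. 3.2.23 (2)] -/
theorem finite_grTotal_obj (X : MixedHodgeStructureCat.{u}) [Module.Finite ℚ X] : Module.Finite ℚ ((grTotal s).obj X) :=
  haveI : Module.Finite ℚ (forget.{u}.obj (of (MixedHodgeStructure.pi fun n : ↥s => (X.str.gr n).toMixedHodgeStructure))) :=
    inferInstanceAs (Module.Finite ℚ (∀ n : ↥s, MixedHodgeStructure.grW X.str.W n))
  Module.Finite.equiv (forget.mapIso (grTotalObjIsoPi s X)).toLinearEquiv.symm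

/-- **The associated graded `(grTotal s) X` is split over `ℚ`** (a direct sum of pure Hodge structures). [cite: GreenGriffithsKerr2012, §I.C (I.C.11) (iii)] -/
theorem isSplitOverQ_grTotal_obj (X : MixedHodgeStructureCat.{u}) [Module.Finite ℚ X] : ((grTotal s).obj X).str.IsSplitOverQ :=
  haveI := finite_grTotal_obj s X
  MixedHodgeStructure.isSplitOverQ_of_hom_pi_pure_bijective (fun n : ↥s => X.str.gr n) (grTotalObjIsoPi s X).inv
    ((isIso_iff_bijective _).1 inferInstance)

/-! ## §3 `X` is split over `ℚ` iff `X ≅ ⨁_j Gr^W_j X` -/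

omit [HasFiniteBiproducts MixedHodgeStructureCat.{u}] s in
/-- The `ℚ`-form of the `n`-th Deligne eigenspace of a `ℚ`-split `X` vanishes when `n` is not a weight. [cite: GreenGriffithsKerr2012, §I.C (I.C.7)–(I.C.8)] -/
theorem weightForm_eq_bot_of_not_isWeight {X : MixedHodgeStructureCat.{u}} (h : X.str.IsSplitOverQ) {n : ℤ} (hn : ¬X.str.IsWeight n) :
    h.weightForm n = ⊥ := by
  have hW : X.str.W (n - 1) = X.str.W n := (X.str.monotone_W (show n - 1 ≤ n by omega)).eq_of_not_lt hn
  rw [← inf_eq_left.2 ((h.weightForm_le_W n).trans hW.symm.le)]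
  exact h.weightForm_inf_W_pred n

/-- **A `ℚ`-split `X` is isomorphic to its associated graded**: `(grTotal s) X ≅ X` for any finite `s` containing the weights of `X`.
[cite: GreenGriffithsKerr2012, §I.C (I.C.7), footnote 3] -/
theorem nonempty_grTotal_obj_iso_of_isSplitOverQ {X : MixedHodgeStructureCat.{u}} (h : X.str.IsSplitOverQ) (hs : ∀ ⦃j⦄, X.str.IsWeight j → j ∈ s) :
    Nonempty ((grTotal s).obj X ≅ X) := by
  obtain ⟨f, hf⟩ := h.exists_hom_pi_gr_bijective (s := s) fun n hn => weightForm_eq_bot_of_not_isWeight h fun hw => hn (hs hw)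
  exact ⟨grTotalObjIsoPi s X ≪≫
    @asIso _ _ (of (MixedHodgeStructure.pi fun n : ↥s => (X.str.gr n).toMixedHodgeStructure)) X f (isIso_of_bijective _ hf)⟩

/-- **Conversely, `X ≅ (grTotal s) X` forces `X` to be split over `ℚ`.** [cite: GreenGriffithsKerr2012, §I.C (I.C.11) (iii)] -/
theorem isSplitOverQ_of_grTotal_obj_iso {X : MixedHodgeStructureCat.{u}} [Module.Finite ℚ X] (e : (grTotal s).obj X ≅ X) : X.str.IsSplitOverQ :=
  haveI := finite_grTotal_obj s X
  (isSplitOverQ_grTotal_obj s X).of_bijective e.hom ((isIso_iff_bijective _).1 inferInstance)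

/-- **`X` is split over `ℚ` iff `(grTotal s) X ≅ X`** (`s ⊇` the weights of `X`): the categorical form of Green–Griffiths–Kerr's "`ℚ`-split MHS =
general Hodge structures `⊕ᵢ Gr^W_i`". [cite: GreenGriffithsKerr2012, §I.C (I.C.7), (I.C.11) (iii), footnote 3] -/
theorem isSplitOverQ_iff_nonempty_grTotal_obj_iso {X : MixedHodgeStructureCat.{u}} [Module.Finite ℚ X] (hs : ∀ ⦃j⦄, X.str.IsWeight j → j ∈ s) :
    X.str.IsSplitOverQ ↔ Nonempty ((grTotal s).obj X ≅ X) :=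
  ⟨fun h => nonempty_grTotal_obj_iso_of_isSplitOverQ s h hs, fun ⟨e⟩ => isSplitOverQ_of_grTotal_obj_iso s e⟩

/-- **A graded-polarizable `ℚ`-split mixed Hodge structure is a semisimple object** of `MixedHodgeStructureCat` (it is isomorphic to its
associated graded, semisimple by g44-#12 `isSemisimpleObj_grTotal_obj`). [cite: VoisinHodgeI2002, §7.3.1 Lemma 7.26] [cite: GreenGriffithsKerr2012, §I.C (I.C.11) (iii)] -/
theorem isSemisimpleObj_of_isSplitOverQ {X : MixedHodgeStructureCat.{u}} (hX : isGradedPolarizable X) (h : X.str.IsSplitOverQ) : IsSemisimpleObj X := by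
  haveI := hX.finite
  obtain ⟨e⟩ := nonempty_grTotal_obj_iso_of_isSplitOverQ X.str.finite_setOf_isWeight.toFinset h fun j hj =>
    X.str.finite_setOf_isWeight.mem_toFinset.2 hj
  exact (isSemisimpleObj_grTotal_obj _ hX).of_iso e.symm

end

end MixedHodgeStructureCat

end Literature.AlgebraicGeometry.Motives

end
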